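import Summits.BirchSwinnertonDyer.BirchSwinnertonDyer.Theorems.KolyvaginDepthDoorDepthTableRowRankThree5077a1NoTwist
import Summits.BirchSwinnertonDyer.BirchSwinnertonDyer.Theorems.KolyvaginDepthDoorKNSupplyLevelOneStructure
import Summits.BirchSwinnertonDyer.BirchSwinnertonDyer.Theorems.KolyvaginDepthDoorKNSupplyResidualStructureOfPrint
import Summits.BirchSwinnertonDyer.BirchSwinnertonDyer.Theorems.KolyvaginDepthDoorDepthTableRowKitPrint
import Literature.NumberTheory.EllipticCurves.LeadingTermPPartRankLeOne
import Literature.NumberTheory.EllipticCurves.SelmerTorsionTwistRestriction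
import Literature.NumberTheory.EllipticCurves.IrreducibleModPQuadraticTwistProofs
import Literature.NumberTheory.EllipticCurves.ComplexMultiplication
import HarnessLib

/-!
# Route `KolyvaginDepthDoor`, crux `KolyvaginDepthSupplyKN` (stmt-BirchSwinnertonDyer-22820) —
# DEPTH TABLE v14: the RANK-ZERO DATUM of the odd-rank row `5077a1` READ AS ONE `L`-VALUE VALUATION
# (Gross–Zagier's twist `E^{(−7)}`; Skinner 2016 Thm. C and Gross–Zagier–Kolyvagin BY NAME)

Helper file of the lead prover of line `levelone` (kdd-p1 g18; `--supports stmt-BirchSwinnertonDyer-22820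
--as helper`); it closes nothing and BSD is NOT proved by it.

The v14 odd-rank rows (`KolyvaginDepthDoorDepthTableSteinWuthrichRankThree{,<label>}`) leave, per curve, ONE
datum: a bound on the `5`-Selmer group of the Heegner twist, of EVEN analytic rank — for `5077a1` and
`K = ℚ(√−7)`, Gross–Zagier's / Buhler–Gross–Zagier's twist `T = E^{(−7)}` with `L(T, 1) ≠ 0` (numerically
`≈ 4.48`). This file reads that datum in `L`-VALUE currency. `T` has the global minimal model
`T₀ = [0, 0, 1, −343, −2144]` (`y² + y = x³ − 343x − 2144`; `Δ = 7⁶·5077`, `N_T = 7²·5077 = 248 773`,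
additive `I₀*` at `7`, multiplicative at `5077`), `ℚ`-isomorphic to the tree's `E.quadraticTwist (−7)` by the
translation `t = −1/2` (`twist_smul_eq`). Kernel certificates (all `decide`): `isElliptic_twist7`,
`isGloballyMinimal_twist7` (no prime has `q⁷ ∣ Δ`; Silverman's `Δ`-criterion with `k = 6`), `intModel_twist7`,
`card_5_twist7` (`#T̃(𝔽₅) = 2`, `a_5(T) = 4`: good ORDINARY), `hasMultiplicativeReductionAtPrime_5077_twist7`
with `v_5077(Δ_T) = 1`, `kodairaNeron_5_twist7` (`5 ∤ ord_v Δ_T` at multiplicative `v`; hence `5 ∤ Tam(T)` — the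
additive fibre has `c_7 ≤ 4`), `hasIrreducibleModPGaloisRep_5_twist7` (twist of the onto `ρ̄_{E,5}`).

* `natCard_selmerGroup_twist7_eq_one_of_LValue` — **Skinner 2016 Thm. C + GZK ⟹ the datum.** IF `L(T, 1) ≠ 0`
  and the algebraic part `L(T,1)/Ω_T ∈ ℚ` has `ord_5 ≤ 0`, THEN `#Sel_5(T/ℚ) = 1`: GZK (`rank T = 0`, `Ш(T)`
  finite), Skinner's `ord_5(L(T,1)/Ω_T) = ord_5 #Ш(T) + ord_5 Tam(T)` (good ordinary `5`, `T[5]` irreducible,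
  the ramified multiplicative prime `5077`), `5 ∤ Tam(T)`, so `5 ∤ #Ш(T)`, `Ш(T)[5] = 0`, and the exact descent
  count with `T(ℚ)[5] = 0`.
* `natCard_selmerGroup_quadraticTwist_neg7_eq_one_of_LValue` — the same transported to `E.quadraticTwist (−7)`
  (`natCard_selmerGroup_eq_of_variableChange`): exactly the hypothesis `hT` of `C5077a1.cruxBody_of_twistSelmer`
  (`…RankThree`) / `exactRowDepth…` with room to spare (`1 ≤ 5^{rank−1}`).

So, modulo FOUR named print facts (Stein–Wuthrich 2013 Thm. 1.1, W. Zhang 2014 L8.4 (1) / Thm. 9.1, Skinner 2016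
Thm. C, Gross–Zagier–Kolyvagin), the crux `KolyvaginDepthSupplyKN` holds AT `5077a1` as soon as ONE exact
rational number — the algebraic part of `L(E^{(−7)}, 1)`, a modular-symbol computation — is a `5`-adic
non-unit-free integer (`ord_5 = 0`) [and `L(E^{(−7)},1) ≠ 0`]: the anticyclotomic depth door at Gross–Zagier's
rank-3 curve, read through the cyclotomic main conjecture of its rank-0 twist. The composition with the crux's
clause is in `…RankThree5077a1Exact` (it needs `…RankThree`). Per curve; nothing class-wide; BSD is NOT proved
by any of this.

References: [Skinner2016PacificMC] Thm. C (p. 173); [Darmon2004] Thm. 3.22 (GZK); [GrossZagier1986] §V.4;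
[SilvermanAEC2009] VII.1 Rem. 1.1, VIII.8, X.4.2, X.5 Cor. 5.4; [CremonaAlgorithms1997] Table 1 (5077a1).
-/

set_option linter.dupNamespace false

noncomputable section

open scoped Classical NumberField

namespace Summit.BirchSwinnertonDyer.BirchSwinnertonDyer.Theorems.KolyvaginDepthDoor

open Literature.NumberTheory.EllipticCurves Literature.NumberTheory.EllipticCurves.ModularForms
  WeierstrassCurve NumberField IsDedekindDomain
open Summit.BirchSwinnertonDyer.BirchSwinnertonDyer.Theorems
open Summit.BirchSwinnertonDyer.BirchSwinnertonDyer.Rank2Observatory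
open Summit.BirchSwinnertonDyer.BirchSwinnertonDyer.Rank1Residual
open Summit.BirchSwinnertonDyer.Rank1Residual.Additive

namespace C5077a1

/-! ## The minimal model `T₀ = [0,0,1,−343,−2144]` of Gross–Zagier's twist `5077a1^{(−7)}` -/

/-- `T₀ = [0,0,1,−343,−2144]` is an elliptic curve over `ℚ` (`Δ = 7⁶·5077 ≠ 0`, kernel-checked). [folklore] -/
theorem isElliptic_twist7 : ((⟨0, 0, 1, -343, -2144⟩ : WeierstrassCurve ℤ).map (Int.castRingHom ℚ)).IsElliptic := by
  rw [WeierstrassCurve.isElliptic_iff, WeierstrassCurve.map_Δ, isUnit_iff_ne_zero, eq_intCast, Int.cast_ne_zero]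
  decide +kernel

/-- **`T₀ = [0,0,1,−343,−2144]` is a GLOBAL MINIMAL model** (unconditional): `Δ(T₀) = 7⁶·5077` is
seventh-power-free (a prime `q` with `q⁷ ∣ Δ` has `q ≤ 17`, and none of those divides to the seventh power),
so Silverman's `Δ`-criterion `isGloballyMinimal_baseChange_int_of_finrank_mul_lt_twelve` applies with `k = 6`.
[cite: SilvermanAEC2009, VII.1 Remark 1.1 and VIII.8] -/
theorem isGloballyMinimal_twist7 :
    ((⟨0, 0, 1, -343, -2144⟩ : WeierstrassCurve ℤ).map (Int.castRingHom ℚ)).IsGloballyMinimal := by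
  have hbc : (⟨0, 0, 1, -343, -2144⟩ : WeierstrassCurve ℤ).map (Int.castRingHom ℚ) =
      (⟨0, 0, 1, -343, -2144⟩ : WeierstrassCurve ℤ).baseChange ℚ := by
    ext <;> simp [WeierstrassCurve.baseChange, WeierstrassCurve.map]
  rw [hbc]
  refine isGloballyMinimal_baseChange_int_of_finrank_mul_lt_twelve _ ℚ 6 (fun q hq hdvd ↦ ?_)
    (by rw [Module.finrank_self]; norm_num)
  have hΔ : (⟨0, 0, 1, -343, -2144⟩ : WeierstrassCurve ℤ).Δ = (597303973 : ℕ) := by decide +kernel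
  rw [hΔ] at hdvd
  have h1 : q ^ 7 ∣ 597303973 := by exact_mod_cast hdvd
  have hle : q ^ 7 ≤ 597303973 := Nat.le_of_dvd (by norm_num) h1
  have hq18 : q < 18 := by
    by_contra h
    have h18 : 18 ^ 7 ≤ q ^ 7 := Nat.pow_le_pow_left (by omega) 7
    norm_num at h18
    omega
  interval_cases q <;> first | (norm_num at hq; done) | exact absurd h1 (by decide)

/-- The integral model `[0,0,1,−343,−2144]` is its own `integralModelInt` (globally minimal). [folklore] -/
theorem intModel_twist7 :
    haveI := isGloballyMinimal_twist7;
    integralModelInt ((⟨0, 0, 1, -343, -2144⟩ : WeierstrassCurve ℤ).map (Int.castRingHom ℚ)) =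
      ⟨0, 0, 1, -343, -2144⟩ := by
  haveI := isGloballyMinimal_twist7
  exact IntModel.integralModelInt_eq_of_map_eq _ rfl

/-- **`T₀` is `ℚ`-isomorphic to the tree's twist `E.quadraticTwist (−7)` of `E = 5077a1`** by the translation
`y ↦ y − 1/2` (`u = 1`, `r = s = 0`, `t = −1/2`): `y² + y = x³ − 343x − 2144` ⟼ `y² = x³ − 343x − 8575/4 =
x³ + (−7)²·b₄/2·x + (−7)³·b₆/4` (`b₂ = 0`, `b₄ = −14`, `b₆ = 25`). [cite: SilvermanAEC2009, X.5 Cor. 5.4] -/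
theorem twist_smul_eq :
    (⟨1, 0, 0, -(1 : ℚ) / 2⟩ : WeierstrassCurve.VariableChange ℚ) •
        ((⟨0, 0, 1, -343, -2144⟩ : WeierstrassCurve ℤ).map (Int.castRingHom ℚ)) =
      (c5077a1.e.baseChange ℚ).quadraticTwist (-7 : ℚ) := by
  haveI := isElliptic_of_mem_atlasR3A00 mem_atlas
  haveI := isGloballyMinimal_of_mem_atlasR3A00 mem_atlas
  have h : c5077a1.e.baseChange ℚ = (⟨0, 0, 1, -7, 6⟩ : WeierstrassCurve ℤ).baseChange ℚ :=
    eq_baseChange_of_intModel intModel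
  rw [h]
  ext <;> simp only [WeierstrassCurve.map_a₁, WeierstrassCurve.map_a₂, WeierstrassCurve.map_a₃,
      WeierstrassCurve.map_a₄, WeierstrassCurve.map_a₆, WeierstrassCurve.variableChange_a₁,
      WeierstrassCurve.variableChange_a₂, WeierstrassCurve.variableChange_a₃,
      WeierstrassCurve.variableChange_a₄, WeierstrassCurve.variableChange_a₆, WeierstrassCurve.quadraticTwist,
      WeierstrassCurve.b₂, WeierstrassCurve.b₄, WeierstrassCurve.b₆, WeierstrassCurve.baseChange, Units.val_one,
      inv_one] <;> norm_num

/-- `#T̃₀(𝔽₅) = 2`, i.e. `a_5(T) = 4 = χ_{−7}(5)·a_5(E)` (kernel-decided). [cite: SilvermanAEC2009, V.2] -/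
theorem card_5_twist7 :
    Nat.card (((⟨0, 0, 1, -343, -2144⟩ : WeierstrassCurve ℤ).map (Int.castRingHom (ZMod 5))).toAffine.Point) =
      2 := by
  rw [PointCountNat.natCard_point_map_eq (hℓ := ⟨by norm_num⟩) (by norm_num) 0 0 1 (-343) (-2144)
    (by decide +kernel)]
  decide +kernel

/-- **`5` is a prime of good ORDINARY reduction for `T`** (`5 ∤ Δ_T`, `a_5(T) = 4`). [cite: SilvermanAEC2009, VII.5 Prop. 5.1 (a)] -/
theorem goodOrdinary_5_twist7 :
    haveI := isGloballyMinimal_twist7;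
    haveI := Fact.mk (by norm_num : Nat.Prime 5);
    ((⟨0, 0, 1, -343, -2144⟩ : WeierstrassCurve ℤ).map (Int.castRingHom ℚ)).HasGoodReductionAtPrime 5 ∧
      ¬ ((5 : ℕ) : ℤ) ∣ ((⟨0, 0, 1, -343, -2144⟩ : WeierstrassCurve ℤ).map (Int.castRingHom ℚ)).frobeniusTrace 5 := by
  haveI := isGloballyMinimal_twist7
  haveI := Fact.mk (by norm_num : Nat.Prime 5)
  exact goodOrdinary_of_intModel_certificate intModel_twist7 5 (by decide +kernel) (n := 2) card_5_twist7
    (by decide +kernel)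

/-- **`T` has multiplicative reduction at `5077` with `v_5077(Δ_T) = 1`** (`5077 ∣ Δ_T = 7⁶·5077`, `5077 ∤ c₄(T) =
16464`): Skinner's ramified auxiliary prime. [cite: SilvermanAEC2009, VII.5 Prop. 5.1 (b)] -/
theorem hasMultiplicativeReductionAtPrime_5077_twist7 :
    haveI := isElliptic_twist7; haveI := isGloballyMinimal_twist7;
    haveI := Fact.mk (by norm_num : Nat.Prime 5077);
    ((⟨0, 0, 1, -343, -2144⟩ : WeierstrassCurve ℤ).map (Int.castRingHom ℚ)).HasMultiplicativeReductionAtPrime 5077 ∧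
      padicValInt 5077 ((⟨0, 0, 1, -343, -2144⟩ : WeierstrassCurve ℤ).map (Int.castRingHom ℚ)).minimalDiscriminantInt = 1 := by
  haveI := isElliptic_twist7
  haveI := isGloballyMinimal_twist7
  haveI := Fact.mk (by norm_num : Nat.Prime 5077)
  refine ⟨IntModel.hasMultiplicativeReductionAtPrime_of_intModel intModel_twist7 5077 (by decide +kernel)
      (by decide +kernel), ?_⟩
  rw [IntModel.minimalDiscriminantInt_eq intModel_twist7]
  exact IntModel.padicValInt_eq_of_dvd_of_not_dvd 5077 (e := 1) (by decide +kernel) (by decide +kernel)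

/-- **Kodaira–Néron for `T` at `5`**: `5 ∤ ord_v(Δ_T)` at every multiplicative place (`Δ_T = 7⁶·5077`: the only
multiplicative prime is `5077`, exponent `1`; the table also certifies `5 ∤ 6` at the additive prime `7`). Hence
`5 ∤ Tam(T)` (`not_dvd_tamagawaProduct_of_kodairaNeron`: `c_v ≤ 4 < 5` at additive `v`).
[cite: SilvermanAEC2009, VII.5.1, VIII.8, C.15 Table 15.1] -/
theorem kodairaNeron_5_twist7 :
    haveI := isElliptic_twist7; haveI := isGloballyMinimal_twist7;
    ∀ v : HeightOneSpectrum (𝓞 ℚ),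
      ((⟨0, 0, 1, -343, -2144⟩ : WeierstrassCurve ℤ).map (Int.castRingHom ℚ)).HasMultiplicativeReductionAt v →
      ¬ 5 ∣ ((⟨0, 0, 1, -343, -2144⟩ : WeierstrassCurve ℤ).map (Int.castRingHom ℚ)).ordMinimalDiscriminant v := by
  haveI := isElliptic_twist7
  haveI := isGloballyMinimal_twist7
  exact not_dvd_ordMinimalDiscriminant_of_intModel_table intModel_twist7 (p := 5) (Δ₀ := 597303973)
    (by decide +kernel) (B := 58) (by decide +kernel) (by decide +kernel)

/-- **`T[5]` is irreducible** — `ρ̄_{E,5}` is onto for `E = 5077a1` (`hasSurjectiveModNGaloisRep_pow_5`), irreducibility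
is twist-invariant (`hasIrreducibleModPGaloisRep_iff_of_smul_eq_quadraticTwist`, Silverman X.5 Cor. 5.4) and `T₀`
is `ℚ`-isomorphic to `E^{(−7)}` (`twist_smul_eq`). [cite: SilvermanAEC2009, X.5 Cor. 5.4] [cite: Serre1972, §5.4 Prop. 21] -/
theorem hasIrreducibleModPGaloisRep_5_twist7 :
    ((⟨0, 0, 1, -343, -2144⟩ : WeierstrassCurve ℤ).map (Int.castRingHom ℚ)).HasIrreducibleModPGaloisRep 5 := by
  haveI := isElliptic_of_mem_atlasR3A00 mem_atlas
  haveI := isGloballyMinimal_of_mem_atlasR3A00 mem_atlas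
  haveI := Fact.mk (by norm_num : Nat.Prime 5)
  have hsur : (c5077a1.e.baseChange ℚ).HasSurjectiveModNGaloisRep (5 : ℕ) := by
    simpa only [pow_one] using hasSurjectiveModNGaloisRep_pow_5 1
  have hirr : (c5077a1.e.baseChange ℚ).HasIrreducibleModPGaloisRep 5 :=
    hasIrreducibleModPGaloisRep_of_hasSurjectiveModNGaloisRep _ 5 hsur
  exact ((c5077a1.e.baseChange ℚ).hasIrreducibleModPGaloisRep_iff_of_smul_eq_quadraticTwist _
    (by norm_num : (-7 : ℚ) ≠ 0) twist_smul_eq 5).mpr hirr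

/-! ## The rank-zero datum as an `L`-value valuation (Skinner 2016 Thm. C, GZK, by name) -/

/-- An abelian group whose `Nat.card` is prime to `p` (so finite) has no `p`-torsion: `Ш ⊓ H¹[p] = ⊥` when
`p ∤ #Ш` (Lagrange: the order of a `p`-torsion element divides `gcd(p, #Ш) = 1`). [folklore] -/
private theorem sha_inf_torsionBy_eq_bot_of_not_dvd_card (V : WeierstrassCurve ℚ) [V.IsElliptic] (p : ℕ)
    (hp : p.Prime) (hnd : ¬ p ∣ Nat.card V.sha) :
    (V.sha ⊓ AddSubgroup.torsionBy V.galH1 (p : ℤ) : AddSubgroup V.galH1) = ⊥ := by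
  rw [eq_bot_iff]
  intro c hc
  obtain ⟨hsha, htor⟩ := AddSubgroup.mem_inf.mp hc
  have hn : p • c = 0 := AddSubgroup.torsionBy.nsmul_iff.mp htor
  set y : V.sha := ⟨c, hsha⟩ with hy
  have hy0 : p • y = 0 := Subtype.ext (by simpa [hy] using hn)
  have h1 : addOrderOf y ∣ p := addOrderOf_dvd_of_nsmul_eq_zero hy0
  have h2 : addOrderOf y ∣ Nat.card V.sha := addOrderOf_dvd_natCard y
  have hcop : Nat.Coprime p (Nat.card V.sha) := (Nat.Prime.coprime_iff_not_dvd hp).mpr hnd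
  have hone : addOrderOf y = 1 := by
    have h := Nat.dvd_gcd h1 h2
    rw [Nat.Coprime.gcd_eq_one hcop] at h
    exact Nat.dvd_one.mp h
  have hy' : y = 0 := AddMonoid.addOrderOf_eq_one_iff.mp hone
  rw [AddSubgroup.mem_bot]
  simpa [hy] using congrArg Subtype.val hy'

/-- **THE RANK-ZERO DATUM OF THE `5077a1` ROW AS ONE `L`-VALUE VALUATION (Skinner 2016 Thm. C + GZK by name).**
For Gross–Zagier's twist `T = 5077a1^{(−7)}` (minimal model `T₀ = [0,0,1,−343,−2144]`): IF `L(T, 1) ≠ 0` and the algebraic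
part `L(T,1)/Ω_T ∈ ℚ` (it is rational, and GZK makes `Ш(T)` finite) satisfies `ord_5(L(T,1)/Ω_T) ≤ 0`, THEN
`#Sel_5(T/ℚ) = 1`. Chain: `r_an(T) = 0` (`analyticRank_eq_zero_of_entireLFunction_one_ne_zero`); GZK (`hGZK`):
`rank T = 0`, `Ш(T)` finite; Skinner 2016 Thm. C (`hSk`; good ordinary `5`, `T[5]` irreducible, the multiplicative prime
`5077` with `5 ∤ v_5077(Δ_T) = 1`): `ord_5(L(T,1)/Ω_T) = ord_5 #Ш(T) + ord_5 Tam(T)`; Kodaira–Néron: `5 ∤ Tam(T)`; so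
`5 ∤ #Ш(T)`, `Ш(T)[5] = 0`, and `#Sel_5(T) = 5^{rank T} = 1` (`T(ℚ)[5] = 0` by irreducibility). CONDITIONAL on the two
named facts; per curve; BSD is not proved by it. [cite: Skinner2016PacificMC, Thm. C (p. 173)] [cite: Darmon2004, Thm. 3.22]
[cite: SilvermanAEC2009, Thm. X.4.2] -/
theorem natCard_selmerGroup_twist7_eq_one_of_LValue
    (hSk : Skinner2016_padicValRat_bsd_rank_zero) (hGZK : rank_eq_analyticRank_of_analyticRank_le_one)
    (hL : haveI := isElliptic_twist7;
      ((⟨0, 0, 1, -343, -2144⟩ : WeierstrassCurve ℤ).map (Int.castRingHom ℚ)).entireLFunction 1 ≠ 0)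
    (hval : haveI := isElliptic_twist7; haveI := isGloballyMinimal_twist7;
      ∀ q : ℚ, ((⟨0, 0, 1, -343, -2144⟩ : WeierstrassCurve ℤ).map (Int.castRingHom ℚ)).entireLFunction 1 /
          ((((⟨0, 0, 1, -343, -2144⟩ : WeierstrassCurve ℤ).map (Int.castRingHom ℚ)).realPeriodRat : ℝ) : ℂ) = (q : ℂ) →
        padicValRat 5 q ≤ 0) :
    haveI := isElliptic_twist7;
    Nat.card (((⟨0, 0, 1, -343, -2144⟩ : WeierstrassCurve ℤ).map (Int.castRingHom ℚ)).selmerGroup (5 : ℕ)) = 1 := by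
  haveI := isElliptic_twist7
  haveI := isGloballyMinimal_twist7
  haveI i5 := Fact.mk (by norm_num : Nat.Prime 5)
  set T := (⟨0, 0, 1, -343, -2144⟩ : WeierstrassCurve ℤ).map (Int.castRingHom ℚ) with hT
  -- analytic rank zero, hence (GZK) rank zero and finite Ш
  have h0 : T.analyticRank = 0 := analyticRank_eq_zero_of_entireLFunction_one_ne_zero T hL
  obtain ⟨hrank, hfin⟩ := hGZK T (by rw [h0]; norm_num)
  rw [h0] at hrank
  -- Skinner 2016 Thm. C at (T, 5)
  haveI i5077 := Fact.mk (by norm_num : Nat.Prime 5077)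
  have hram : ∃ q : ℕ, ∃ _ : Fact q.Prime, q ≠ 5 ∧ T.HasMultiplicativeReductionAtPrime q ∧
      ¬ 5 ∣ padicValInt q T.minimalDiscriminantInt :=
    ⟨5077, i5077, by norm_num, hasMultiplicativeReductionAtPrime_5077_twist7.1,
      by rw [hasMultiplicativeReductionAtPrime_5077_twist7.2]; norm_num⟩
  obtain ⟨q, hq, hv⟩ := hSk T 5 (by norm_num) (Or.inl goodOrdinary_5_twist7) hasIrreducibleModPGaloisRep_5_twist7
    hram hL hfin
  have hv0 : padicValRat 5 q ≤ 0 := hval q hq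
  have htam : ¬ 5 ∣ T.tamagawaProduct := not_dvd_tamagawaProduct_of_kodairaNeron T 5 le_rfl kodairaNeron_5_twist7
  have htam0 : padicValNat 5 T.tamagawaProduct = 0 := padicValNat.eq_zero_of_not_dvd htam
  have hle : ((padicValNat 5 T.shaOrder : ℕ) : ℤ) + ((padicValNat 5 T.tamagawaProduct : ℕ) : ℤ) ≤ 0 := by
    rw [← hv]; exact hv0
  have hsha0 : padicValNat 5 T.shaOrder = 0 := by omega
  -- `5 ∤ #Ш(T)`, so `Ш(T)[5] = 0`
  haveI : Finite T.sha := hfin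
  have hpos : T.shaOrder ≠ 0 := by
    rw [WeierstrassCurve.shaOrder]; exact Nat.card_pos.ne'
  have hnd : ¬ 5 ∣ T.shaOrder := by
    rcases padicValNat.eq_zero_iff.mp hsha0 with h | h | h
    · norm_num at h
    · exact absurd h hpos
    · exact h
  have hshaT : (T.sha ⊓ AddSubgroup.torsionBy T.galH1 ((5 : ℕ) : ℤ) : AddSubgroup T.galH1) = ⊥ :=
    sha_inf_torsionBy_eq_bot_of_not_dvd_card T 5 (by norm_num) (by rwa [WeierstrassCurve.shaOrder] at hnd)
  rw [natCard_selmerGroup_eq_pow_rank_of_sha_inf_torsionBy_eq_bot T 5 hasIrreducibleModPGaloisRep_5_twist7 hshaT,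
    hrank, pow_zero]

/-- **The same datum on the tree's twist `E.quadraticTwist (−7)`** (`E = 5077a1`): under the two `L`-value hypotheses,
`#Sel_5(E^{(−7)}/ℚ) = 1` — transported along the `ℚ`-isomorphism `twist_smul_eq` (`natCard_selmerGroup_eq_of_variableChange`).
This is (more than) the hypothesis `hT : #Sel_5(E^{(d_K)}) ≤ 5³` of `C5077a1.cruxBody_of_twistSelmer` for every `K` with
`d_K = −7`. CONDITIONAL on Skinner 2016 Thm. C and GZK by name; per curve; BSD is not proved by it.
[cite: Skinner2016PacificMC, Thm. C (p. 173)] [cite: Darmon2004, Thm. 3.22] [cite: SilvermanAEC2009, X.§4] -/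
theorem natCard_selmerGroup_quadraticTwist_neg7_eq_one_of_LValue
    (hSk : Skinner2016_padicValRat_bsd_rank_zero) (hGZK : rank_eq_analyticRank_of_analyticRank_le_one)
    (hL : haveI := isElliptic_twist7;
      ((⟨0, 0, 1, -343, -2144⟩ : WeierstrassCurve ℤ).map (Int.castRingHom ℚ)).entireLFunction 1 ≠ 0)
    (hval : haveI := isElliptic_twist7; haveI := isGloballyMinimal_twist7;
      ∀ q : ℚ, ((⟨0, 0, 1, -343, -2144⟩ : WeierstrassCurve ℤ).map (Int.castRingHom ℚ)).entireLFunction 1 /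
          ((((⟨0, 0, 1, -343, -2144⟩ : WeierstrassCurve ℤ).map (Int.castRingHom ℚ)).realPeriodRat : ℝ) : ℂ) = (q : ℂ) →
        padicValRat 5 q ≤ 0) :
    haveI := isElliptic_of_mem_atlasR3A00 mem_atlas;
    Nat.card (((c5077a1.e.baseChange ℚ).quadraticTwist (-7 : ℚ)).selmerGroup (5 : ℕ)) = 1 := by
  rw [← natCard_selmerGroup_eq_of_variableChange ((5 : ℕ) : ℤ) twist_smul_eq]
  exact natCard_selmerGroup_twist7_eq_one_of_LValue hSk hGZK hL hval

end C5077a1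

end Summit.BirchSwinnertonDyer.BirchSwinnertonDyer.Theorems.KolyvaginDepthDoor

end
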